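import Summits.QuantumFields.BalabanUV.T4Continuum.Spine.NE3.PairLandauB8End
import HarnessLib

/-!
# Route «BalabanUVNodes», cluster K4 «SpineRates» — node N16 = NE3: THE END AT HÖLDER EXPONENT `β` (class-generic core).
# The slice-generic endpoint-chart END and the junction on [B8]'s surface with the (1.36) Hölder member carried at its PRINTED exponent
# «β ≦ β₀ < 1»: `PairLandauGaugeB8Avg d 𝒞 L N b g s₁ s₂ β dom` ∧ (per pair) the chart data ⟹ the covariant root WITH (Lip₂′ᶜ) AT `ξ^{2+β}`

Cell `pub-ymgap`, seat `pub-ymgap-dag-n16-c` (R134 fan-out seat, strategy s1; HUMAN RULING D-0062; chair R424 venue), generation 2, file 9 — the producer-side core of the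
repair R-β of the located item «the Hölder-exponent pin of N16's N05-socket» (`HOME/pub-ymgap-dag-n16-c/LOCATED-N16-HOLDER-PIN.md`; pub-ymgap INBOX
DAGN16C-G2-LOCATED-1∕-1b); companion of file 8 `BalabanUVNodesN16HolderWindow` (the consumer side).  `--supports stmt-QuantumFields-19908` (helper).
`bears_on: R4∕N16 · edge N05 → N16`.

WHY.  THE END of row NE3 (`Spine/NE3/PairLandauB8End.ne3EnergyRateWCov_of_pairLandauGaugeB8Avg` over the slice-generic END
`Support/NE3EnergyRateWCovOfEndpointChart.ne3EnergyRateWCov_of_endpointChart_slice`) consumes [Balaban1985RegularSpaces] Theorem 2 at the pair in the shape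
`PairLandauGaugeB8Avg d 𝒞 L N b g s₁ s₂ 1 dom` — Hölder exponent `β := 1` — only because the root `NE3EnergyRateWCov` words its third conjunct at `ξ^3`; the
Hölder member is PASSED THROUGH (the energy conjunct is β-free: `energyNormW_le_of_endpointChart_slice`).  Print has «β ≦ β₀ < 1» ((1.36) p. 82); the typed
shape `LandauRepB8 … s₂ β` carries `holder ≤ s₂·ξ^{(2:ℝ)+β}` for every `β`.  THIS FILE is the same two theorems with the exponent a LETTER: the output is the
root's `∃ (u, Z)` body with (Lip₂′ᶜ) at `ξ^{2+β}` (the hypothesis `h` of file 8's `closeness_of_covRoot_holder`), written inline — no statement of record is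
touched (a β-root `def` is planner business).

WHAT THIS FILE PROVES (kernel, theorems only, 0 `def`, 0 sorry):
§1 `covRoot_holder_of_endpointChart_slice` — the slice-generic END at exponent `β` (class-generic; `d ≥ 1`, `L, N ≥ 1`): per-pair endpoint charts on direction
   sets carrying (P♮), (RES♯), the budget, and the two covariant conjuncts of the chart's start `Γ 0` at `ξ²` ∕ `ξ^{2+β}` ⟹ the β-root with
   `C := (1+θ₀)(4∕cΛ)C′`.  Proof = the original's (`energyNormW_le_of_endpointChart_slice` BY NAME + pass-through).
§2 `covRoot_holder_of_pairLandauGaugeB8Avg` — THE END's junction at exponent `β`: `PairLandauGaugeB8Avg d 𝒞 L N b g s₁ s₂ β dom` ∧ (per pair, per B8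
   representative) `DecomposedRepT` on `slicB8` starting at the B8 direction ∧ (P♮)∕(RES♯) on `slicB8` ∧ the k-free letters ⟹ the β-root with `Λ₁ = s₁`,
   `Λ₂′ = s₂`.  Proof = the original's (product-path chart + zero-extension BY NAME; `LandauRepB8.holder` verbatim instead of `rpow_two_add_one`).
§3 `landauRepB8_one_of_holder` ∕ `landauRepB8Avg_one_of_holder` ∕ `landauRepB8_holder_of_one` — the PER-PAIR EXPONENT EXCHANGE `(s₂, β) ↔ (s₂·ξ^{β−1}, 1)` at one
   level: every per-pair supplier of the `sfClass` stack (typed at `… s₁ s₂ 1`, output `s₂`-free) is fed from the β-shape by name; only the class-level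
   top statements of the stack need `1 ↦ β` twins (the exchanged letter is not k-uniform).
HONEST FRAMING: kernel bookkeeping over landed modules of the pub-balaban ∕ pub-balaban-gaps NE3 lineages; `PairLandauGaugeB8Avg … β` ([B8] Thm 2 + (1.37) at
the pair) and the chart data are HYPOTHESES; nothing of Bałaban's proved; NE3 ∕ N16 NOT discharged; count-neutral; one finite four-torus at fixed ε — NOT ℝ⁴,
NOT infinite volume, NOT OS, NOT a mass gap, NOT Clay.
-/

set_option autoImplicit false

open scoped BigOperators Matrix Matrix.Norms.L2Operator
open NormedSpace Finset

namespace Summit.QuantumFields.YangMills.BalabanUVNodes.N16HolderEnd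

open Set
open Literature.MathematicalPhysics.QuantumFieldTheory.Balaban1983to89
open B7Prop1Explicit B7Prop2Explicit
open T4AveragingDeficitWall hiding Site Plane Plaq Bond
open T4AveragingDeficitWallBoundary (periodBox)
open Summit.QuantumFields.BalabanUV.T4Continuum
open AveragingDeficitPeriodicCounting (IsPeriodicDir)
open AveragingDeficitChartCalculus (cavg)
open MinimalActionSandwich (IsMinimiser)
open MinimalActionRate (Regular)
open NE3EnergyShapes (residualScale residualScale_nonneg IsUnitarySite IsPeriodicSite)
open NE3EnergyWeightedShapes (energyNormW CurlPairedResidual)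
open NE3SlicePoincareShape (SlicePoincare)
open NE3EndpointChart (EndpointChart)
open NE3EnergyRateWSupOfSlicePoincare (cLambda)
open NE3EnergyRateWCovOfEndpointChart (energyNormW_le_of_endpointChart_slice)
open NE3ProductPath (pathΓ)
open NE3ProductPathChartSlice (DecomposedRepT endpointChart_of_decomposedRepT)
open NE3EndpointPackageOfDecomposedRep (extPath extPath_of_mem mem_window_of_mem_Icc isSkewDir_extPath isPeriodicDir_extPath norm_extPath_le
  endpointChart_congr_path)
open NE3.PairLandauB8 (LandauRepB8)
open NE3.PairLandauB8Avg (LandauRepB8Avg PairLandauGaugeB8Avg slicB8 skew_of_mem_slicB8 periodic_of_mem_slicB8)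

noncomputable section

variable {d : ℕ} {n : Type*} [Fintype n] [DecidableEq n]

/-! ## §1 The slice-generic END at exponent `β` -/

/-- **THE COVARIANT ROOT WITH (Lip₂′ᶜ) AT `ξ^{2+β}` FROM ENDPOINT CHARTS ON ANY DIRECTION SETS** (class-generic; `d ≥ 1`, `L, N ≥ 1`):
`Support/NE3EnergyRateWCovOfEndpointChart.ne3EnergyRateWCov_of_endpointChart_slice` with its last hypothesis and the third conjunct of its conclusion at
exponent `(2:ℝ)+β` instead of `3`.  Per pair: an endpoint chart on `T` (skew, periodic members) in the weighted norm, sup-radius `α`, plaquette radius `a`,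
(P♮) `SlicePoincare … CP`, (RES♯) `CurlPairedResidual … (C′·residualScale …)`, the two regularity inequalities, and for the chart's start `Γ 0` the covariant
conjuncts (Lip₁ᶜ) `≤ Λ₁ξ²`, (Lip₂′ᶜ)_β `≤ Λ₂′ξ^{2+β}`; budget `2Λθ + Λθ² + κ + 2q ≤ cΛ∕2`.  THEN for every `k ≥ 1`, datum and minimiser pair: `∃ (u, Z)`
(:= `(u, Γ 0)`) unitary∕periodic, skew∕periodic, `gaugeAct u U_A = vary W Z 1`, `energyNormW … ≤ (1+θ₀)(4∕cΛ)C′·residualScale …`, (Lip₁ᶜ), (Lip₂′ᶜ)_β.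
The energy conjunct is `energyNormW_le_of_endpointChart_slice` BY NAME; the covariant conjuncts are passed through. [folklore] -/
theorem covRoot_holder_of_endpointChart_slice [Nonempty n] (hd : 1 ≤ d) {𝒞 : ℕ → Set (Site d → Fin d → (Matrix n n ℂ)ˣ)}
    {L N : ℕ} (hL : 1 ≤ L) (hN : 1 ≤ N) {b g : ℝ} {dom : Set (Site d → Fin d → (Matrix n n ℂ)ˣ)}
    {CP Λ θ κ θ₀ q C' Λ₁ Λ₂' β : ℝ}
    (hCP : 0 ≤ CP) (hreg₁ : CP * (Real.sqrt Λ - 1) ^ 2 ≤ 1 / 4) (hθ₀ : 0 ≤ θ₀) (hC' : 0 ≤ C')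
    (hbudget : 2 * Λ * θ + Λ * θ ^ 2 + κ + 2 * q ≤ cLambda n CP Λ / 2)
    (hchart : ∀ k : ℕ, 1 ≤ k → ∀ V ∈ dom, ∀ UA UB : Site d → Fin d → (Matrix n n ℂ)ˣ,
      IsMinimiser d 𝒞 L N k V UA → IsMinimiser d 𝒞 L N (k + 1) V UB → Regular d L N b g (k + 1) UB →
        IsUnitaryCfg (cavg L UB) ∧
        ∃ (T : Set (Site d → Fin d → Matrix n n ℂ)) (u : Site d → (Matrix n n ℂ)ˣ)
          (Γ Ψ Ψ' : ℝ → Site d → Fin d → Matrix n n ℂ) (Xref : Site d → Fin d → Matrix n n ℂ) (α a : ℝ),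
          (∀ Y ∈ T, IsSkewDir Y) ∧ (∀ Y ∈ T, IsPeriodicDir Y ((N * L ^ k : ℕ) : ℤ)) ∧ 0 ≤ α ∧ 0 ≤ a ∧
          EndpointChart 𝒞 L N k V UA UB u Γ Ψ Ψ' Xref T
            (fun Y => energyNormW L k (cavg L UB) Y (periodBox (N * L ^ k))) θ κ θ₀ q a ∧
          (∀ t (x : Site d) (μ : Fin d), ‖Γ t x μ‖ ≤ α) ∧
          (1 + 24 * Real.sqrt d * (Real.exp α - 1) * (L : ℝ) ^ k) ^ 2 + 48 * d * a * ((L : ℝ) ^ k) ^ 2 ≤ Λ ∧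
          112 * (d : ℝ) * a * CP * ((L : ℝ) ^ k) ^ 2 ≤ 1 / (2 * (Fintype.card n : ℝ)) ∧
          SlicePoincare L k (cavg L UB) T CP (periodBox (N * L ^ k)) ∧
          CurlPairedResidual L k (cavg L UB) T (C' * residualScale d L N b g k) (periodBox (N * L ^ k)) ∧
          (∀ (κ : Fin d) (x : Site d) (μ : Fin d),
            ‖Ad (cavg L UB (x + e κ) μ) (Γ 0 (x + e μ) κ) - Γ 0 x κ‖ ≤ Λ₁ * (((L : ℝ)⁻¹) ^ k) ^ 2) ∧
          (∀ (κ μ : Fin d) (y : Site d),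
            ‖Ad (cavg L UB (y + e κ) μ)
                (Ad (cavg L UB (y + e κ + e μ) μ) (Γ 0 (y + (2 : ℕ) • e μ) κ) - Γ 0 (y + e μ) κ)
              - (Ad (cavg L UB (y + e κ) μ) (Γ 0 (y + e μ) κ) - Γ 0 y κ)‖ ≤ Λ₂' * (((L : ℝ)⁻¹) ^ k) ^ ((2 : ℝ) + β))) :
    ∀ k : ℕ, 1 ≤ k → ∀ V ∈ dom, ∀ UA UB : Site d → Fin d → (Matrix n n ℂ)ˣ,
      IsMinimiser d 𝒞 L N k V UA → IsMinimiser d 𝒞 L N (k + 1) V UB → Regular d L N b g (k + 1) UB →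
        ∃ (u : Site d → (Matrix n n ℂ)ˣ) (Z : Site d → Fin d → Matrix n n ℂ),
          IsUnitarySite u ∧ IsPeriodicSite u ((N * L ^ k : ℕ) : ℤ) ∧
          IsSkewDir Z ∧ IsPeriodicDir Z ((N * L ^ k : ℕ) : ℤ) ∧
          gaugeAct u UA = vary (rescale L (bavg L UB)) Z 1 ∧
          energyNormW L k (rescale L (bavg L UB)) Z (periodBox (N * L ^ k))
            ≤ ((1 + θ₀) * (4 / cLambda n CP Λ) * C') * residualScale d L N b g k ∧
          (∀ (κ : Fin d) (x : Site d) (μ : Fin d),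
            ‖Ad (rescale L (bavg L UB) (x + e κ) μ) (Z (x + e μ) κ) - Z x κ‖ ≤ Λ₁ * (((L : ℝ)⁻¹) ^ k) ^ 2) ∧
          (∀ (κ μ : Fin d) (y : Site d),
            ‖Ad (rescale L (bavg L UB) (y + e κ) μ)
                (Ad (rescale L (bavg L UB) (y + e κ + e μ) μ) (Z (y + (2 : ℕ) • e μ) κ) - Z (y + e μ) κ)
              - (Ad (rescale L (bavg L UB) (y + e κ) μ) (Z (y + e μ) κ) - Z y κ)‖ ≤ Λ₂' * (((L : ℝ)⁻¹) ^ k) ^ ((2 : ℝ) + β)) := by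
  intro k hk V hV UA UB hA hB hreg
  obtain ⟨hW, T, u, Γ, Ψ, Ψ', Xref, α, a, hskewT, hperT, hα, ha, hpath, hΓα, hΛw, hreg₂, hP, hres, h1, h2⟩ :=
    hchart k hk V hV UA UB hA hB hreg
  have hr : 0 ≤ C' * residualScale d L N b g k := mul_nonneg hC' (residualScale_nonneg d L N b g k)
  obtain ⟨hend, -⟩ := energyNormW_le_of_endpointChart_slice hd hL hN hW hskewT hperT hCP hreg₁ hθ₀ hr hbudget hα ha hpath
    hΓα hΛw hreg₂ hP hres hA
  have hcv : cavg L UB = rescale L (bavg L UB) := rfl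
  rw [hcv] at hend h1 h2
  refine ⟨u, Γ 0, hpath.gauge.1, hpath.gauge.2, hpath.skew 0, hpath.per 0, hpath.rep, ?_, h1, h2⟩
  refine hend.trans (le_of_eq ?_)
  ring

/-! ## §2 THE END's junction on [B8]'s surface at exponent `β` -/

/-- **THE END ON B8's SURFACE AT EXPONENT `β` — the β-root ⇐ `PairLandauGaugeB8Avg … s₁ s₂ β` ∧ (per pair, per representative) `DecomposedRepT` ON `slicB8`
STARTING AT THE B8 DIRECTION ∧ (P♮)∕(RES♯) ON `slicB8` ∧ k-FREE LETTERS** (class-generic; `d ≥ 1`, `L, N ≥ 1`): `Spine/NE3/PairLandauB8End.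
ne3EnergyRateWCov_of_pairLandauGaugeB8Avg` with the B8 shape at exponent `β` ([Balaban1985RegularSpaces] (1.36) «β ≦ β₀ < 1») and the conclusion the
β-root (`Λ₁ = s₁`, `Λ₂′ = s₂`, `C = (1 + (ν + 23√2·√(16d+1)·(1+ν)))·(4∕cΛ)·C′`).  Same proof: product-path chart on `slicB8`, zero-extension of its path,
§1; `LandauRepB8.grad` and `LandauRepB8.holder` VERBATIM for the two covariant conjuncts. [folklore] -/
theorem covRoot_holder_of_pairLandauGaugeB8Avg [Nonempty n] (hd : 1 ≤ d) {𝒞 : ℕ → Set (Site d → Fin d → (Matrix n n ℂ)ˣ)}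
    {L N : ℕ} (hL : 1 ≤ L) (hN : 1 ≤ N) {b g s₁ s₂ β : ℝ} {dom : Set (Site d → Fin d → (Matrix n n ℂ)ˣ)}
    {ν κ₁ κ₂ CP Λ C' : ℝ} (hCP : 0 ≤ CP) (hreg₁ : CP * (Real.sqrt Λ - 1) ^ 2 ≤ 1 / 4) (hν : 0 ≤ ν) (hC' : 0 ≤ C')
    (hbudget : 2 * Λ * (2 * (1 + 4 * Real.sqrt (16 * d + 1)) * ν) + Λ * (2 * (1 + 4 * Real.sqrt (16 * d + 1)) * ν) ^ 2
        + (2 * κ₁ + 912 * d * κ₂) ≤ cLambda n CP Λ / 2)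
    (hB8 : PairLandauGaugeB8Avg d 𝒞 L N b g s₁ s₂ β dom)
    (hsupp : ∀ k : ℕ, 1 ≤ k → ∀ V ∈ dom, ∀ UA UB : Site d → Fin d → (Matrix n n ℂ)ˣ,
      IsMinimiser d 𝒞 L N k V UA → IsMinimiser d 𝒞 L N (k + 1) V UB → Regular d L N b g (k + 1) UB →
      ∀ (u : Site d → (Matrix n n ℂ)ˣ) (Z : Site d → Fin d → Matrix n n ℂ), LandauRepB8Avg L N k (cavg L UB) UA u Z s₁ s₂ β →
        IsUnitaryCfg (cavg L UB) ∧
        ∃ (X Nn : Site d → Fin d → Matrix n n ℂ) (α αN a : ℝ),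
          DecomposedRepT 𝒞 L N k V UA UB u X Nn (slicB8 L N k (cavg L UB)) α αN ν κ₁ κ₂ a ∧
          pathΓ X Nn 0 = Z ∧ α ≤ 1 / 40 ∧ αN ≤ 1 / 100 ∧
          (1 + 24 * Real.sqrt d * (Real.exp (10 * (α + αN)) - 1) * (L : ℝ) ^ k) ^ 2 + 48 * d * a * ((L : ℝ) ^ k) ^ 2 ≤ Λ ∧
          112 * (d : ℝ) * a * CP * ((L : ℝ) ^ k) ^ 2 ≤ 1 / (2 * (Fintype.card n : ℝ)) ∧
          SlicePoincare L k (cavg L UB) (slicB8 L N k (cavg L UB)) CP (periodBox (N * L ^ k)) ∧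
          CurlPairedResidual L k (cavg L UB) (slicB8 L N k (cavg L UB)) (C' * residualScale d L N b g k) (periodBox (N * L ^ k))) :
    ∀ k : ℕ, 1 ≤ k → ∀ V ∈ dom, ∀ UA UB : Site d → Fin d → (Matrix n n ℂ)ˣ,
      IsMinimiser d 𝒞 L N k V UA → IsMinimiser d 𝒞 L N (k + 1) V UB → Regular d L N b g (k + 1) UB →
        ∃ (u : Site d → (Matrix n n ℂ)ˣ) (Z : Site d → Fin d → Matrix n n ℂ),
          IsUnitarySite u ∧ IsPeriodicSite u ((N * L ^ k : ℕ) : ℤ) ∧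
          IsSkewDir Z ∧ IsPeriodicDir Z ((N * L ^ k : ℕ) : ℤ) ∧
          gaugeAct u UA = vary (rescale L (bavg L UB)) Z 1 ∧
          energyNormW L k (rescale L (bavg L UB)) Z (periodBox (N * L ^ k))
            ≤ ((1 + (ν + 23 * Real.sqrt 2 * Real.sqrt (16 * d + 1) * (1 + ν))) * (4 / cLambda n CP Λ) * C') * residualScale d L N b g k ∧
          (∀ (κ : Fin d) (x : Site d) (μ : Fin d),
            ‖Ad (rescale L (bavg L UB) (x + e κ) μ) (Z (x + e μ) κ) - Z x κ‖ ≤ s₁ * (((L : ℝ)⁻¹) ^ k) ^ 2) ∧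
          (∀ (κ μ : Fin d) (y : Site d),
            ‖Ad (rescale L (bavg L UB) (y + e κ) μ)
                (Ad (rescale L (bavg L UB) (y + e κ + e μ) μ) (Z (y + (2 : ℕ) • e μ) κ) - Z (y + e μ) κ)
              - (Ad (rescale L (bavg L UB) (y + e κ) μ) (Z (y + e μ) κ) - Z y κ)‖ ≤ s₂ * (((L : ℝ)⁻¹) ^ k) ^ ((2 : ℝ) + β)) := by
  have hθ₀ : 0 ≤ ν + 23 * Real.sqrt 2 * Real.sqrt (16 * d + 1) * (1 + ν) := by positivity
  have hbudget' : 2 * Λ * (2 * (1 + 4 * Real.sqrt (16 * d + 1)) * ν) + Λ * (2 * (1 + 4 * Real.sqrt (16 * d + 1)) * ν) ^ 2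
      + (2 * κ₁ + 912 * d * κ₂) + 2 * 0 ≤ cLambda n CP Λ / 2 := by simpa using hbudget
  refine covRoot_holder_of_endpointChart_slice hd hL hN hCP hreg₁ hθ₀ hC' hbudget' ?_
  intro k hk V hV UA UB hA hB hreg
  obtain ⟨u, Z, hZ⟩ := hB8 k hk V hV UA UB hA hB hreg
  obtain ⟨hW, X, Nn, α, αN, a, hdec, hΓ0, hα, hαN, hJ1, hJ2, hP, hres⟩ := hsupp k hk V hV UA UB hA hB hreg u Z hZ
  -- the product-path chart on `slicB8`, then the zero-extension of its path (global sup `10(α+αN)`)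
  have hchart := endpointChart_of_decomposedRepT hL hN hW hdec
  have hchart' := endpointChart_congr_path (Γ' := extPath X Nn) hchart (fun t ht => extPath_of_mem ht) (isSkewDir_extPath X Nn)
    (isPeriodicDir_extPath hdec.perX hdec.perN)
  have hsup : ∀ t (x : Site d) (μ : Fin d), ‖extPath X Nn t x μ‖ ≤ 10 * (α + αN) :=
    fun t x μ => norm_extPath_le hdec.skewX hdec.skewN hdec.supX hdec.supN hα hαN t x μ
  have hα' : 0 ≤ 10 * (α + αN) := by linarith [hdec.hα0, hdec.hαN0]
  -- the extended path starts at the B8 direction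
  have h0 : extPath X Nn 0 = Z := by
    rw [extPath_of_mem (mem_window_of_mem_Icc ⟨le_rfl, zero_le_one⟩), hΓ0]
  refine ⟨hW, slicB8 L N k (cavg L UB), u, extPath X Nn, _, _, X, 10 * (α + αN), a,
    fun Y hY => skew_of_mem_slicB8 hY, fun Y hY => periodic_of_mem_slicB8 hY, hα', hdec.ha, hchart', hsup, hJ1, hJ2, hP, hres, ?_, ?_⟩
  · intro κ x μ
    rw [h0]
    exact hZ.grad κ x μ
  · intro κ μ y
    rw [h0]
    exact hZ.holder κ μ y

/-! ## §3 The per-pair EXPONENT EXCHANGE: at a fixed level the β-shape is the `β = 1` shape with the level-dependent letter `s₂·ξ^{β−1}` -/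

/-- `ξ^{β−1}·ξ^{2+1} = ξ^{2+β}` for `ξ = (L⁻¹)^k > 0`. [folklore] -/
theorem xi_rpow_exchange {L : ℕ} (hL : 1 ≤ L) (k : ℕ) (β : ℝ) :
    (((L : ℝ)⁻¹) ^ k) ^ (β - 1) * (((L : ℝ)⁻¹) ^ k) ^ ((2 : ℝ) + 1) = (((L : ℝ)⁻¹) ^ k) ^ ((2 : ℝ) + β) := by
  have hξ : 0 < ((L : ℝ)⁻¹) ^ k := pow_pos (inv_pos.mpr (by exact_mod_cast (by omega : 0 < L))) k
  rw [← Real.rpow_add hξ]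
  ring_nf

/-- **EXPONENT EXCHANGE FOR THE B8 REPRESENTATIVE AT ONE LEVEL**: `LandauRepB8 L N k W U_A u Z s₁ s₂ β → LandauRepB8 L N k W U_A u Z s₁ (s₂·ξ^{β−1}) 1`
(`ξ = (L⁻¹)^k`, `L ≥ 1`) — every field verbatim, the Hölder member re-read as `s₂·ξ^{2+β} = (s₂·ξ^{β−1})·ξ^3`.  The exchanged letter `s₂·ξ^{β−1} = s₂·L^{k(1−β)}`
is NOT uniform in `k` for `β < 1` — which is exactly why the exchange serves every PER-PAIR supplier of THE END's `sfClass` stack whose output does not read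
`s₂` (the decomposition `DecomposedRepT`, the Π-REG majorant, (P♮), the Landau correction: all typed at `LandauRepB8Avg … s₁ s₂ 1` in one pair), but NOT the
class-level hypothesis `PairLandauGaugeB8Avg … s₁ s₂ 1 dom` (one `s₂` for all levels): the R-β re-thread of the stack is TOP-LEVEL STATEMENTS ONLY, all per-pair
suppliers reused by name through this lemma, the junction being §2. [folklore] -/
theorem landauRepB8_one_of_holder {L N k : ℕ} (hL : 1 ≤ L) {W UA : Site d → Fin d → (Matrix n n ℂ)ˣ} {u : Site d → (Matrix n n ℂ)ˣ}
    {Z : Site d → Fin d → Matrix n n ℂ} {s₁ s₂ β : ℝ} (h : LandauRepB8 L N k W UA u Z s₁ s₂ β) :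
    LandauRepB8 L N k W UA u Z s₁ (s₂ * (((L : ℝ)⁻¹) ^ k) ^ (β - 1)) 1 where
  unitary := h.unitary
  periodic := h.periodic
  skew := h.skew
  per := h.per
  rep := h.rep
  landau := h.landau
  sup := h.sup
  grad := h.grad
  holder := fun κ μ y => (h.holder κ μ y).trans (le_of_eq (by rw [mul_assoc, xi_rpow_exchange hL k β]))
  lap := h.lap

/-- The same WITH (1.37): `LandauRepB8Avg … s₁ s₂ β → LandauRepB8Avg … s₁ (s₂·ξ^{β−1}) 1` at one level. [folklore] -/
theorem landauRepB8Avg_one_of_holder {L N k : ℕ} (hL : 1 ≤ L) {W UA : Site d → Fin d → (Matrix n n ℂ)ˣ} {u : Site d → (Matrix n n ℂ)ˣ}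
    {Z : Site d → Fin d → Matrix n n ℂ} {s₁ s₂ β : ℝ} (h : LandauRepB8Avg L N k W UA u Z s₁ s₂ β) :
    LandauRepB8Avg L N k W UA u Z s₁ (s₂ * (((L : ℝ)⁻¹) ^ k) ^ (β - 1)) 1 where
  toLandauRepB8 := landauRepB8_one_of_holder hL h.toLandauRepB8
  dbar := h.dbar

/-- … and back: the `β = 1` shape at the exchanged letter returns the β-shape (so the exchange loses nothing at one level). [folklore] -/
theorem landauRepB8_holder_of_one {L N k : ℕ} (hL : 1 ≤ L) {W UA : Site d → Fin d → (Matrix n n ℂ)ˣ} {u : Site d → (Matrix n n ℂ)ˣ}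
    {Z : Site d → Fin d → Matrix n n ℂ} {s₁ s₂ β : ℝ} (h : LandauRepB8 L N k W UA u Z s₁ (s₂ * (((L : ℝ)⁻¹) ^ k) ^ (β - 1)) 1) :
    LandauRepB8 L N k W UA u Z s₁ s₂ β where
  unitary := h.unitary
  periodic := h.periodic
  skew := h.skew
  per := h.per
  rep := h.rep
  landau := h.landau
  sup := h.sup
  grad := h.grad
  holder := fun κ μ y => (h.holder κ μ y).trans (le_of_eq (by rw [mul_assoc, xi_rpow_exchange hL k β]))
  lap := h.lap

end

end Summit.QuantumFields.YangMills.BalabanUVNodes.N16HolderEnd
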